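import Mathlib

/-!
# Two-family set differences: the separated Marica–Schönheim inequality

Helper file for crux `stmt-CriticalPhenomena-4575` (`NoHeavyLowerTail`, route `PercNearOneGluingNoHeavy`),
factory seat `prim-ineq-gen-3` (gen 4); companion of
`PercNearOneGluingNoHeavyLowerTailOrientedAntipodalHallChain`, whose chain-class Hall count is proved there
modulo the two-family Marica–Schönheim inequality `MS2′`
(`#𝒞 + #ℬ ≤ #((𝒞 \\ 𝒞) ∪ (𝒞 \\ ℬ) ∪ (ℬ \\ ℬ))` whenever no member of `𝒞` is contained in a member of `ℬ`).

Here we prove, for ARBITRARY finite families `𝒞, ℬ` of finite sets (no hypothesis),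

  `#𝒞 + #ℬ ≤ #((𝒞 \\ 𝒞) ∪ (ℬ \\ ℬ)) + #(𝒞 \\ ℬ)`            (`card_add_card_le_card_diffs_union_add_card_diffs`)

by the member/non-member section induction that also proves the Marica–Schönheim inequality, and deduce
`MS2′` for *separated* pairs, i.e. when some element lies in every member of `𝒞` and in no member of `ℬ`
(`card_add_card_le_card_diffs_union_three_of_separated`): then the cross differences `C \ B` all contain that
element while the pure differences do not, so the union is disjoint.  This is strictly stronger than what the
Marica–Schönheim inequality for the lifted family `𝒞 ∪ {B ∪ {∞}}` gives (that keeps the junk block `ℬ \\ 𝒞`).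
(prim-ineq-gen-3 gen 4, 2026-08-20; memo `run/shared/lean/prim/prim-ineq-gen-3/COMB.md` §3c (xiv).)
-/

namespace Summit.CriticalPhenomena.PercolationContinuityZ3.Theorems

namespace TwoFamilyDifferences

open Finset
open scoped FinsetFamily

variable {α : Type*} [DecidableEq α]

/-- Splitting a set family at an element: `#𝒜` is the number of sets in the union of the two sections plus
the number in their intersection. -/
theorem card_eq_card_union_sections_add_card_inter_sections (a : α) (𝒜 : Finset (Finset α)) :
    #𝒜 = #(𝒜.nonMemberSubfamily a ∪ 𝒜.memberSubfamily a) +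
      #(𝒜.nonMemberSubfamily a ∩ 𝒜.memberSubfamily a) := by
  rw [card_union_add_card_inter, add_comm, card_memberSubfamily_add_card_nonMemberSubfamily]

/-- Differences of members of the union of the two sections of `𝒳` (at `a`) by members of the union of the two
sections of `𝒴` are sections of differences. -/
theorem diffs_sections_subset (a : α) (𝒳 𝒴 : Finset (Finset α)) :
    (𝒳.nonMemberSubfamily a ∪ 𝒳.memberSubfamily a) \\ (𝒴.nonMemberSubfamily a ∪ 𝒴.memberSubfamily a) ⊆
      (𝒳 \\ 𝒴).nonMemberSubfamily a ∪ (𝒳 \\ 𝒴).memberSubfamily a := by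
  intro T hT
  rw [mem_diffs] at hT
  obtain ⟨X, hX, Y, hY, rfl⟩ := hT
  rw [mem_union, mem_nonMemberSubfamily, mem_memberSubfamily] at hX hY ⊢
  have haXY : a ∉ X \ Y := by
    intro h
    rcases hX with hX | hX <;> exact hX.2 (mem_sdiff.mp h).1
  rcases hX with ⟨hX, haX⟩ | ⟨hX, haX⟩ <;> rcases hY with ⟨hY, haY⟩ | ⟨hY, haY⟩
  · -- X ∈ 𝒳, Y ∈ 𝒴
    exact Or.inl ⟨mem_diffs.mpr ⟨X, hX, Y, hY, rfl⟩, haXY⟩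
  · -- X ∈ 𝒳, insert a Y ∈ 𝒴 : X \ insert a Y = X \ Y
    refine Or.inl ⟨mem_diffs.mpr ⟨X, hX, insert a Y, hY, ?_⟩, haXY⟩
    ext x
    simp only [mem_sdiff, mem_insert, not_or]
    constructor
    · rintro ⟨hx, -, hxY⟩; exact ⟨hx, hxY⟩
    · rintro ⟨hx, hxY⟩; exact ⟨hx, fun h => haX (h ▸ hx), hxY⟩
  · -- insert a X ∈ 𝒳, Y ∈ 𝒴 : insert a X \ Y = insert a (X \ Y)
    refine Or.inr ⟨mem_diffs.mpr ⟨insert a X, hX, Y, hY, ?_⟩, haXY⟩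
    ext x
    simp only [mem_sdiff, mem_insert]
    constructor
    · rintro ⟨hx | hx, hxY⟩
      · exact Or.inl hx
      · exact Or.inr ⟨hx, hxY⟩
    · rintro (rfl | ⟨hx, hxY⟩)
      · exact ⟨Or.inl rfl, haY⟩
      · exact ⟨Or.inr hx, hxY⟩
  · -- insert a X ∈ 𝒳, insert a Y ∈ 𝒴 : difference is X \ Y
    refine Or.inl ⟨mem_diffs.mpr ⟨insert a X, hX, insert a Y, hY, ?_⟩, haXY⟩
    ext x
    simp only [mem_sdiff, mem_insert, not_or]
    constructor
    · rintro ⟨hx | hx, hxa, hxY⟩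
      · exact absurd hx hxa
      · exact ⟨hx, hxY⟩
    · rintro ⟨hx, hxY⟩
      exact ⟨Or.inr hx, fun h => haX (h ▸ hx), hxY⟩

/-- Differences of members of the intersection of the two sections lie in both sections of the differences. -/
theorem diffs_inter_sections_subset (a : α) (𝒳 𝒴 : Finset (Finset α)) :
    (𝒳.nonMemberSubfamily a ∩ 𝒳.memberSubfamily a) \\ (𝒴.nonMemberSubfamily a ∩ 𝒴.memberSubfamily a) ⊆
      (𝒳 \\ 𝒴).nonMemberSubfamily a ∩ (𝒳 \\ 𝒴).memberSubfamily a := by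
  intro T hT
  rw [mem_diffs] at hT
  obtain ⟨X, hX, Y, hY, rfl⟩ := hT
  rw [mem_inter, mem_nonMemberSubfamily, mem_memberSubfamily] at hX hY ⊢
  obtain ⟨⟨hX, haX⟩, hX', -⟩ := hX
  obtain ⟨⟨hY, haY⟩, -, -⟩ := hY
  have haXY : a ∉ X \ Y := fun h => haX (mem_sdiff.mp h).1
  refine ⟨⟨mem_diffs.mpr ⟨X, hX, Y, hY, rfl⟩, haXY⟩, ⟨mem_diffs.mpr ⟨insert a X, hX', Y, hY, ?_⟩, haXY⟩⟩
  ext x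
  simp only [mem_sdiff, mem_insert]
  constructor
  · rintro ⟨hx | hx, hxY⟩
    · exact Or.inl hx
    · exact Or.inr ⟨hx, hxY⟩
  · rintro (rfl | ⟨hx, hxY⟩)
    · exact ⟨Or.inl rfl, haY⟩
    · exact ⟨Or.inr hx, hxY⟩

/-- Members of a section are subsets of the ground finset with the sectioning element removed. -/
theorem subset_of_mem_sections {a : α} {u : Finset α} {𝒜 : Finset (Finset α)}
    (h𝒜 : ∀ s ∈ 𝒜, s ⊆ insert a u) {s : Finset α}
    (hs : s ∈ 𝒜.nonMemberSubfamily a ∪ 𝒜.memberSubfamily a) : s ⊆ u := by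
  rw [mem_union, mem_nonMemberSubfamily, mem_memberSubfamily] at hs
  rcases hs with ⟨hs, has⟩ | ⟨hs, has⟩
  · intro x hx
    have := h𝒜 s hs hx
    rcases mem_insert.mp this with rfl | h
    · exact absurd hx has
    · exact h
  · intro x hx
    have := h𝒜 _ hs (mem_insert_of_mem hx)
    rcases mem_insert.mp this with rfl | h
    · exact absurd hx has
    · exact h

/-- The induction behind Theorem S: for families of subsets of a fixed finset `u`. -/
theorem card_add_card_le_aux (u : Finset α) :
    ∀ 𝒞 ℬ : Finset (Finset α), (∀ s ∈ 𝒞, s ⊆ u) → (∀ s ∈ ℬ, s ⊆ u) →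
      #𝒞 + #ℬ ≤ #((𝒞 \\ 𝒞) ∪ (ℬ \\ ℬ)) + #(𝒞 \\ ℬ) := by
  induction u using Finset.induction_on with
  | empty =>
    intro 𝒞 ℬ h𝒞 hℬ
    have h𝒞' : 𝒞 ⊆ {∅} := fun s hs => mem_singleton.mpr (subset_empty.mp (h𝒞 s hs))
    have hℬ' : ℬ ⊆ {∅} := fun s hs => mem_singleton.mpr (subset_empty.mp (hℬ s hs))
    rcases subset_singleton_iff.mp h𝒞' with rfl | rfl <;>
      rcases subset_singleton_iff.mp hℬ' with rfl | rfl
    · simp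
    · simp
    · simp
    · simp
  | insert a u hau ih =>
    intro 𝒞 ℬ h𝒞 hℬ
    -- sections
    set 𝒞₀ := 𝒞.nonMemberSubfamily a with h𝒞₀
    set 𝒞₁ := 𝒞.memberSubfamily a with h𝒞₁
    set ℬ₀ := ℬ.nonMemberSubfamily a with hℬ₀
    set ℬ₁ := ℬ.memberSubfamily a with hℬ₁
    set U := (𝒞 \\ 𝒞) ∪ (ℬ \\ ℬ) with hU
    set V := 𝒞 \\ ℬ with hV
    -- ground-set bounds for the sectioned families
    have hC' : ∀ s ∈ 𝒞₀ ∪ 𝒞₁, s ⊆ u := fun s hs => subset_of_mem_sections h𝒞 hs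
    have hB' : ∀ s ∈ ℬ₀ ∪ ℬ₁, s ⊆ u := fun s hs => subset_of_mem_sections hℬ hs
    have hCI : ∀ s ∈ 𝒞₀ ∩ 𝒞₁, s ⊆ u := fun s hs => hC' s (mem_union_left _ (mem_inter.mp hs).1)
    have hBI : ∀ s ∈ ℬ₀ ∩ ℬ₁, s ⊆ u := fun s hs => hB' s (mem_union_left _ (mem_inter.mp hs).1)
    -- induction hypotheses for the projected pair and the double pair
    have ih' := ih (𝒞₀ ∪ 𝒞₁) (ℬ₀ ∪ ℬ₁) hC' hB'
    have ihI := ih (𝒞₀ ∩ 𝒞₁) (ℬ₀ ∩ ℬ₁) hCI hBI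
    -- containments
    have hU' : ((𝒞₀ ∪ 𝒞₁) \\ (𝒞₀ ∪ 𝒞₁)) ∪ ((ℬ₀ ∪ ℬ₁) \\ (ℬ₀ ∪ ℬ₁)) ⊆
        U.nonMemberSubfamily a ∪ U.memberSubfamily a := by
      rw [hU, nonMemberSubfamily_union, memberSubfamily_union]
      intro T hT
      rcases mem_union.mp hT with hT | hT
      · have := diffs_sections_subset a 𝒞 𝒞 hT
        rcases mem_union.mp this with h | h
        · exact mem_union_left _ (mem_union_left _ h)
        · exact mem_union_right _ (mem_union_left _ h)
      · have := diffs_sections_subset a ℬ ℬ hT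
        rcases mem_union.mp this with h | h
        · exact mem_union_left _ (mem_union_right _ h)
        · exact mem_union_right _ (mem_union_right _ h)
    have hUI : ((𝒞₀ ∩ 𝒞₁) \\ (𝒞₀ ∩ 𝒞₁)) ∪ ((ℬ₀ ∩ ℬ₁) \\ (ℬ₀ ∩ ℬ₁)) ⊆
        U.nonMemberSubfamily a ∩ U.memberSubfamily a := by
      rw [hU, nonMemberSubfamily_union, memberSubfamily_union]
      intro T hT
      rcases mem_union.mp hT with hT | hT
      · have := mem_inter.mp (diffs_inter_sections_subset a 𝒞 𝒞 hT)
        exact mem_inter.mpr ⟨mem_union_left _ this.1, mem_union_left _ this.2⟩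
      · have := mem_inter.mp (diffs_inter_sections_subset a ℬ ℬ hT)
        exact mem_inter.mpr ⟨mem_union_right _ this.1, mem_union_right _ this.2⟩
    have hV' : (𝒞₀ ∪ 𝒞₁) \\ (ℬ₀ ∪ ℬ₁) ⊆ V.nonMemberSubfamily a ∪ V.memberSubfamily a :=
      diffs_sections_subset a 𝒞 ℬ
    have hVI : (𝒞₀ ∩ 𝒞₁) \\ (ℬ₀ ∩ ℬ₁) ⊆ V.nonMemberSubfamily a ∩ V.memberSubfamily a :=
      diffs_inter_sections_subset a 𝒞 ℬ
    -- assemble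
    have eC := card_eq_card_union_sections_add_card_inter_sections a 𝒞
    have eB := card_eq_card_union_sections_add_card_inter_sections a ℬ
    have eU := card_eq_card_union_sections_add_card_inter_sections a U
    have eV := card_eq_card_union_sections_add_card_inter_sections a V
    have c1 := card_le_card hU'
    have c2 := card_le_card hUI
    have c3 := card_le_card hV'
    have c4 := card_le_card hVI
    rw [← h𝒞₀, ← h𝒞₁] at eC
    rw [← hℬ₀, ← hℬ₁] at eB
    omega

/-- **Theorem S** (two-family Marica–Schönheim, separated form).  For arbitrary finite families `𝒞, ℬ` of
finite sets, `#𝒞 + #ℬ ≤ #((𝒞 \\ 𝒞) ∪ (ℬ \\ ℬ)) + #(𝒞 \\ ℬ)`. -/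
theorem card_add_card_le_card_diffs_union_add_card_diffs (𝒞 ℬ : Finset (Finset α)) :
    #𝒞 + #ℬ ≤ #((𝒞 \\ 𝒞) ∪ (ℬ \\ ℬ)) + #(𝒞 \\ ℬ) :=
  card_add_card_le_aux (𝒞.sup id ∪ ℬ.sup id) 𝒞 ℬ
    (fun _ hs => (le_sup (f := id) hs).trans subset_union_left)
    (fun _ hs => (le_sup (f := id) hs).trans subset_union_right)

/-- **MS2′ for separated pairs.**  If some element `a` lies in every member of `𝒞` and in no member of `ℬ`
(in particular no member of `𝒞` is contained in a member of `ℬ`), then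
`#𝒞 + #ℬ ≤ #((𝒞 \\ 𝒞) ∪ (𝒞 \\ ℬ) ∪ (ℬ \\ ℬ))`. -/
theorem card_add_card_le_card_diffs_union_three_of_separated (𝒞 ℬ : Finset (Finset α)) {a : α}
    (h𝒞 : ∀ C ∈ 𝒞, a ∈ C) (hℬ : ∀ B ∈ ℬ, a ∉ B) :
    #𝒞 + #ℬ ≤ #((𝒞 \\ 𝒞) ∪ (𝒞 \\ ℬ) ∪ (ℬ \\ ℬ)) := by
  have hdisj : Disjoint ((𝒞 \\ 𝒞) ∪ (ℬ \\ ℬ)) (𝒞 \\ ℬ) := by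
    rw [disjoint_left]
    intro T hT hT'
    obtain ⟨C, hC, B, hB, rfl⟩ := mem_diffs.mp hT'
    have haT : a ∈ C \ B := mem_sdiff.mpr ⟨h𝒞 C hC, hℬ B hB⟩
    rcases mem_union.mp hT with hT | hT
    · obtain ⟨C₁, -, C₂, hC₂, h⟩ := mem_diffs.mp hT
      exact (mem_sdiff.mp (h ▸ haT)).2 (h𝒞 C₂ hC₂)
    · obtain ⟨B₁, hB₁, B₂, -, h⟩ := mem_diffs.mp hT
      exact hℬ B₁ hB₁ (mem_sdiff.mp (h ▸ haT)).1
  calc #𝒞 + #ℬ ≤ #((𝒞 \\ 𝒞) ∪ (ℬ \\ ℬ)) + #(𝒞 \\ ℬ) :=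
        card_add_card_le_card_diffs_union_add_card_diffs 𝒞 ℬ
    _ = #(((𝒞 \\ 𝒞) ∪ (ℬ \\ ℬ)) ∪ (𝒞 \\ ℬ)) := (card_union_of_disjoint hdisj).symm
    _ = #((𝒞 \\ 𝒞) ∪ (𝒞 \\ ℬ) ∪ (ℬ \\ ℬ)) := by
        congr 1
        ext T
        simp only [mem_union]
        tauto

end TwoFamilyDifferences

end Summit.CriticalPhenomena.PercolationContinuityZ3.Theorems
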